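import Summits.QuantumFields.YangMills.Theorems.BalabanUVNodesN12FlatRightInverseLetterFloor

/-!
# BalabanUVNodes ∕ N12 — (J-b) module H4b: THE LETTER FLOOR IN WEIGHTED CURRENCIES — any weight `w` on the enumerated rows, and print's η-units
# `q_η(v)² := Σ_i L^{(d−2)·j_i}·‖v i‖²_HS`, in which the floor is the k-UNIFORM number `‖↑E‖²_op ≤ 16·ρ²·‖E‖²_HS` (`ρ ≥ 1∕(4√N)`)

Cell `pub-ymgap` (HUMAN RULINGS D-0062 ∕ D-0149), width seat `pub-ymgap-dag-n10-w1` g4; module H4 = `…N12FlatRightInverseLetterFloor` (p625544).  `--kind proof --supports stmt-QuantumFields-27364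
--as helper` (K1⁹, KEY MAP v2); count-neutral; THEOREMS ONLY (0 `def`, 0 `sorry`).  Item (i-a) of dag-n12-c g18's LANE WORD «LOCATED-RHO ⇒ exit (b)» (INBOX 2026-08-28 l.35963): the right-inverse
letter of J-C's package (N) re-read in print's level-weighted units ([Balaban1989LargeFieldII] (17)–(19) pp.360–361), so that dag-n12-w5's (χ) letter `B15Prop1NearFlatPackageFromLetters` can pin
`q := q_η` (this file spells `q_η` as the explicit lambda `fun v => Real.sqrt (∑ i, ((L^d)∕(L²))^{j_i} * ‖v i‖²)`, `j_i = ((constrEnum 𝔹 k).symm i).1`; a named `def` follows in a Defs file).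

WHY THESE WEIGHTS (LOCATED-RHO-2, l.≈36157).  Module H4's floor says a unit level-`j` datum costs at least `L^{(d−2)j∕2}∕(4√N)` in the bond-`ℓ²` (operator) seminorm `p`; the minimal-norm right
inverse costs `≍ L^{(d−2)j∕2}` (one level: `Q_jQ_j^* ≍ L^{−dj}`), so `q_η(v)² = Σ_i L^{(d−2)j_i}‖v i‖²` is the currency in which an O(1) letter is POSSIBLE (for the optimal inverse — item (i-c),
print's (46) class, crux-sized) and in which the floor is the k-uniform `ρ ≥ 1∕(4√N)`; LOCAL lifts (far-face ∕ column lifts, modules H1a–H3) cost `L^{(d−1)j∕2}` and have `ρ² ≍ L^k` here (item (i-b)).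

CONTENTS (ns `Summit.QuantumFields.YangMills.BalabanUVNodes.N12FlatRightInverseLetterFloorWeighted`).  §1 ★ `letter_floor_of_reproduce_bound` (H4's core with an arbitrary bound `p(Y) ≤ B`
in place of `ρ‖v‖`), ★ `letter_floor_of_reproduce_single_weighted` (test datum `δ_{i₁}·E`, ANY weight `w`: `(L^d)^j·‖↑E‖² ≤ 16·(L²)^j·ρ²·w(i₁)·‖E‖²`).  §2 (J-C's currency at
`Bj M₁ Z k`, level `k`) ★★★ `letter_floor_fderiv_msChart_one_Bj_weighted` (any `w`), ★★★ `letter_floor_fderiv_msChart_one_Bj_eta` (η-units: `‖↑E‖²_op ≤ 16·ρ²·‖E‖²_HS`), ★★★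
`letter_floor_fderiv_msChart_one_Bj_eta_numeral` (`1 ≤ 16·N·ρ²`, one non-zero `E ∈ 𝔰𝔲(N)`).

HONEST FRAMING.  A lower bound on one letter, now currency-parametrised; the O(1) UPPER letter is NOT claimed (it is the (46)-class estimate of [Balaban1985Variational] (44)–(46), open here);
nothing of Bałaban's asserted or denied; N12 ∕ N10 NOT discharged; K1⁹ NOT closed; count-neutral (typed 28∕28 · discharged 5∕27 unmoved); one finite 𝕋⁴ programme at fixed ε — R4 closes the
conditional finite-𝕋⁴ rung `BalabanLadder.UV` only; the YM mass gap (Clay) is NOT proved by any of this; nothing continuum ∕ ℝ⁴ ∕ OS.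
-/

noncomputable section
open scoped BigOperators Matrix.Norms.L2Operator
open Finset
namespace Summit.QuantumFields.YangMills.BalabanUVNodes.N12FlatRightInverseLetterFloorWeighted

open Literature.MathematicalPhysics.QuantumFieldTheory.Balaban1983to89
open LatticeFieldCalculus (bondAvgIter)
open T4Continuum (T4Family)
open BlockAveragingEMLLinearised (linAvg)
open T4AdjointCovarianceUnitary (lieSU)
open B15DeterminingSets
open B14.Eq213DetSet (Bj maxDomT Bj_top)
open Node00
open Summit.QuantumFields.YangMills.Theorems.ChartHInv (exists_linFamily)
open Summit.QuantumFields.YangMills.BalabanUVNodes.N12FlatChartDerivIterLin (iterLin_eq_of_rightInverse)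
open Summit.QuantumFields.YangMills.BalabanUVNodes.N12FlatRightInverseLetterFloor (letter_floor_of_reproduce norm_sq_lieSU_le_card_mul_opNorm_sq constrEnum_ne_of_ne)

variable {P : Params}

/-! ## §1  The core with an arbitrary bound, and the weighted test datum -/

section Core

variable {N : ℕ} {ι : Type*} [Fintype ι]
variable (Q : (i : ℕ) → (PBond P 0 → Matrix (Fin N) (Fin N) ℂ) → PBond P i → Matrix (Fin N) (Fin N) ℂ)
  (hQ0 : ∀ Y, Q 0 Y = Y) (hQs : ∀ (i : ℕ) (Y : PBond P 0 → Matrix (Fin N) (Fin N) ℂ) (c : PBond P (i + 1)), Q (i + 1) Y c = linAvg (Q i Y) c)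

include hQ0 hQs in
/-- ★ **THE LETTER FLOOR, CORE FORM, ARBITRARY BOUND**: as H4's `letter_floor_of_reproduce` with `p(Y) ≤ B` (any real `B`) in place of `p(Y) ≤ ρ‖v‖`:
`‖↑(v i₁) + ↑(v i₂) − ↑(v i₃) − ↑(v i₄)‖²·(L^d)^j ≤ 16·(L²)^j·B²` (reduction to H4: `ρ := B∕‖v‖` if `v ≠ 0`; both sides vanish at `v = 0`).
[cite: Balaban1985Variational, (44)-(46) p.285; Balaban1984PropagatorsI, (1.18) p.20] -/
theorem letter_floor_of_reproduce_bound {j : ℕ} (hj : j ≤ P.m + P.K) (x : Site P j) (μ ν : Fin P.d)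
    (p : Seminorm ℝ (PBond P 0 → lieSU (Fin N))) (hp : ∀ Y : PBond P 0 → lieSU (Fin N), ∑ b, ‖(Y b : Matrix (Fin N) (Fin N) ℂ)‖ ^ 2 ≤ p Y ^ 2)
    (Y : PBond P 0 → lieSU (Fin N)) (v : ι → lieSU (Fin N)) (i₁ i₂ i₃ i₄ : ι)
    (h₁ : Q j (fun b => (Y b : Matrix (Fin N) (Fin N) ℂ)) ⟨x, μ⟩ = (v i₁ : Matrix (Fin N) (Fin N) ℂ))
    (h₂ : Q j (fun b => (Y b : Matrix (Fin N) (Fin N) ℂ)) ⟨x.shift μ, ν⟩ = (v i₂ : Matrix (Fin N) (Fin N) ℂ))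
    (h₃ : Q j (fun b => (Y b : Matrix (Fin N) (Fin N) ℂ)) ⟨x.shift ν, μ⟩ = (v i₃ : Matrix (Fin N) (Fin N) ℂ))
    (h₄ : Q j (fun b => (Y b : Matrix (Fin N) (Fin N) ℂ)) ⟨x, ν⟩ = (v i₄ : Matrix (Fin N) (Fin N) ℂ))
    {B : ℝ} (hY : p Y ≤ B) :
    ‖(v i₁ : Matrix (Fin N) (Fin N) ℂ) + v i₂ - v i₃ - v i₄‖ ^ 2 * ((P.L : ℝ) ^ P.d) ^ j ≤ 16 * ((P.L : ℝ) ^ 2) ^ j * B ^ 2 := by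
  by_cases hv : v = 0
  · subst hv
    simp only [Pi.zero_apply, ZeroMemClass.coe_zero, add_zero, sub_zero, norm_zero, ne_eq, OfNat.ofNat_ne_zero, not_false_eq_true, zero_pow, zero_mul]
    positivity
  · have hvn : ‖v‖ ≠ 0 := fun h => hv (norm_eq_zero.mp h)
    have hρ : p Y ≤ B / ‖v‖ * ‖v‖ := by rwa [div_mul_cancel₀ B hvn]
    have h := letter_floor_of_reproduce Q hQ0 hQs hj x μ ν p hp Y v i₁ i₂ i₃ i₄ h₁ h₂ h₃ h₄ hρ
    rwa [div_mul_cancel₀ B hvn] at h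

include hQ0 hQs in
/-- ★ **TEST DATUM `δ_{i₁}·E` IN A WEIGHTED CURRENCY**: for a WHOLE map `Rf` reproducing the four plaquette constraints of every datum, with `p(Rf v) ≤ ρ·√(Σ_i w_i‖v i‖²)` for a weight `w`
with `0 ≤ w i₁`, and `i₂, i₃, i₄ ≠ i₁`: for every `E ∈ 𝔰𝔲(N)`, `(L^d)^j·‖↑E‖²_op ≤ 16·(L²)^j·ρ²·w(i₁)·‖E‖²_HS`.
[cite: Balaban1985Variational, (44)-(46) p.285; Balaban1989LargeFieldII, (17)-(19) pp.360-361] -/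
theorem letter_floor_of_reproduce_single_weighted [DecidableEq ι] {j : ℕ} (hj : j ≤ P.m + P.K) (x : Site P j) (μ ν : Fin P.d)
    (p : Seminorm ℝ (PBond P 0 → lieSU (Fin N))) (hp : ∀ Y : PBond P 0 → lieSU (Fin N), ∑ b, ‖(Y b : Matrix (Fin N) (Fin N) ℂ)‖ ^ 2 ≤ p Y ^ 2)
    (Rf : (ι → lieSU (Fin N)) → PBond P 0 → lieSU (Fin N)) (i₁ i₂ i₃ i₄ : ι) (h₂₁ : i₂ ≠ i₁) (h₃₁ : i₃ ≠ i₁) (h₄₁ : i₄ ≠ i₁)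
    (h₁ : ∀ v, Q j (fun b => (Rf v b : Matrix (Fin N) (Fin N) ℂ)) ⟨x, μ⟩ = (v i₁ : Matrix (Fin N) (Fin N) ℂ))
    (h₂ : ∀ v, Q j (fun b => (Rf v b : Matrix (Fin N) (Fin N) ℂ)) ⟨x.shift μ, ν⟩ = (v i₂ : Matrix (Fin N) (Fin N) ℂ))
    (h₃ : ∀ v, Q j (fun b => (Rf v b : Matrix (Fin N) (Fin N) ℂ)) ⟨x.shift ν, μ⟩ = (v i₃ : Matrix (Fin N) (Fin N) ℂ))
    (h₄ : ∀ v, Q j (fun b => (Rf v b : Matrix (Fin N) (Fin N) ℂ)) ⟨x, ν⟩ = (v i₄ : Matrix (Fin N) (Fin N) ℂ))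
    (w : ι → ℝ) (hw : 0 ≤ w i₁) {ρ : ℝ} (hρ : ∀ v, p (Rf v) ≤ ρ * Real.sqrt (∑ i, w i * ‖v i‖ ^ 2)) (E : lieSU (Fin N)) :
    ((P.L : ℝ) ^ P.d) ^ j * ‖(E : Matrix (Fin N) (Fin N) ℂ)‖ ^ 2 ≤ 16 * ((P.L : ℝ) ^ 2) ^ j * ρ ^ 2 * (w i₁ * ‖E‖ ^ 2) := by
  set v : ι → lieSU (Fin N) := Pi.single i₁ E with hv
  have hsum : ∑ i, w i * ‖v i‖ ^ 2 = w i₁ * ‖E‖ ^ 2 := by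
    rw [Finset.sum_eq_single i₁ (fun i _ hi => by simp [hv, Pi.single_eq_of_ne hi]) (fun h => absurd (Finset.mem_univ _) h)]
    simp [hv]
  have hmain := letter_floor_of_reproduce_bound Q hQ0 hQs hj x μ ν p hp (Rf v) v i₁ i₂ i₃ i₄ (h₁ v) (h₂ v) (h₃ v) (h₄ v) (hρ v)
  have hv₁ : v i₁ = E := by simp [hv]
  have hv₂ : v i₂ = 0 := by simp [hv, Pi.single_eq_of_ne h₂₁]
  have hv₃ : v i₃ = 0 := by simp [hv, Pi.single_eq_of_ne h₃₁]
  have hv₄ : v i₄ = 0 := by simp [hv, Pi.single_eq_of_ne h₄₁]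
  rw [hv₁, hv₂, hv₃, hv₄, hsum] at hmain
  simp only [ZeroMemClass.coe_zero, add_zero, sub_zero] at hmain
  have hsq : (ρ * Real.sqrt (w i₁ * ‖E‖ ^ 2)) ^ 2 = ρ ^ 2 * (w i₁ * ‖E‖ ^ 2) := by
    rw [mul_pow, Real.sq_sqrt (mul_nonneg hw (sq_nonneg _))]
  rw [hsq] at hmain
  calc ((P.L : ℝ) ^ P.d) ^ j * ‖(E : Matrix (Fin N) (Fin N) ℂ)‖ ^ 2 = ‖(E : Matrix (Fin N) (Fin N) ℂ)‖ ^ 2 * ((P.L : ℝ) ^ P.d) ^ j := mul_comm _ _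
    _ ≤ 16 * ((P.L : ℝ) ^ 2) ^ j * (ρ ^ 2 * (w i₁ * ‖E‖ ^ 2)) := hmain
    _ = 16 * ((P.L : ℝ) ^ 2) ^ j * ρ ^ 2 * (w i₁ * ‖E‖ ^ 2) := by ring

end Core

/-! ## §2  J-C's currency at `𝐁_k(Z)`, level `k`: any weight, then print's η-units -/

section Record

variable {F : T4Family} {N : ℕ} [NeZero N] {K : ℕ}

/-- ★★★ **THE WEIGHTED FLOOR AT `Bj M₁ Z k`, LEVEL `k`**: as H4's `letter_floor_fderiv_msChart_one_Bj_single` but with `hρ : p(Rf v) ≤ ρ·√(Σ_i w_i‖v i‖²)` for ANY weight `w` on the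
enumerated rows (non-negative at the test row `i₁ =` the index of `⟨x, μ⟩`): `(L^d)^k·‖↑E‖²_op ≤ 16·(L²)^k·ρ²·w(i₁)·‖E‖²_HS` for every `E ∈ 𝔰𝔲(N)`.
[cite: Balaban1988Convergent, (2.13) pp.256-257, (2.10)-(2.12) p.256; Balaban1985Variational, (44)-(48) p.285; Balaban1989LargeFieldII, (17)-(19) pp.360-361] -/
theorem letter_floor_fderiv_msChart_one_Bj_weighted {k M₁ : ℕ} {Z : Set (Site (F.P K) 0)} (hk : k ≤ (F.P K).m + (F.P K).K) (x : Site (F.P K) k) {μ ν : Fin (F.P K).d}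
    (hμν : μ ≠ ν) (hx : x.shift ν ≠ x) (h₀ : embIter k x ∈ maxDomT M₁ Z k) (hμ : embIter k (x.shift μ) ∈ maxDomT M₁ Z k) (hν : embIter k (x.shift ν) ∈ maxDomT M₁ Z k)
    (p : Seminorm ℝ (PBond (F.P K) 0 → lieSU (Fin N))) (hp : ∀ Y : PBond (F.P K) 0 → lieSU (Fin N), ∑ b, ‖(Y b : Matrix (Fin N) (Fin N) ℂ)‖ ^ 2 ≤ p Y ^ 2)
    (Rf : (Fin (constrCard (Bj M₁ Z k : DetSet (F.P K)) k) → lieSU (Fin N)) → PBond (F.P K) 0 → lieSU (Fin N))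
    (hRf : ∀ v, fderiv ℝ (msChart F N K k (Bj M₁ Z k) (avgFamily (avOfRecord F N K) (1 : GaugeField (F.P K) 0 (SU N))) (1 : GaugeField (F.P K) 0 (SU N))) 0 (Rf v) = v)
    (w : Fin (constrCard (Bj M₁ Z k : DetSet (F.P K)) k) → ℝ) (hw : ∀ i, 0 ≤ w i) {ρ : ℝ}
    (hρ : ∀ v, p (Rf v) ≤ ρ * Real.sqrt (∑ i, w i * ‖v i‖ ^ 2)) (E : lieSU (Fin N)) :
    (((F.P K).L : ℝ) ^ (F.P K).d) ^ k * ‖(E : Matrix (Fin N) (Fin N) ℂ)‖ ^ 2 ≤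
      16 * (((F.P K).L : ℝ) ^ 2) ^ k * ρ ^ 2 * (w (constrEnum (Bj M₁ Z k : DetSet (F.P K)) k ⟨⟨k, Nat.lt_succ_self k⟩, ⟨x, μ⟩, by rw [Bj_top]; exact Or.inl h₀⟩) * ‖E‖ ^ 2) := by
  have hrow : ∀ c : PBond (F.P K) k, embIter k c.src ∈ maxDomT M₁ Z k → c ∈ bondsOf ((Bj M₁ Z k : DetSet (F.P K)) k) := fun c hc => by
    rw [Bj_top]; exact Or.inl hc
  obtain ⟨Q, hQ0, hQs⟩ := exists_linFamily (P := F.P K) (n := Fin N)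
  have key : ∀ (v : Fin (constrCard (Bj M₁ Z k : DetSet (F.P K)) k) → lieSU (Fin N)) (idx : ConstrSet (Bj M₁ Z k : DetSet (F.P K)) k),
      Q (idx.1 : ℕ) (fun b => (Rf v b : Matrix (Fin N) (Fin N) ℂ)) idx.2.1 = (v (constrEnum _ k idx) : Matrix (Fin N) (Fin N) ℂ) := by
    intro v idx
    have h := iterLin_eq_of_rightInverse (F := F) (N := N) (K := K) (k := k) Q hQ0 hQs (Bj M₁ Z k) Rf hRf v (constrEnum _ k idx)
    rwa [Equiv.symm_apply_apply] at h
  exact letter_floor_of_reproduce_single_weighted Q hQ0 hQs hk x μ ν p hp Rf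
    (constrEnum _ k ⟨⟨k, Nat.lt_succ_self k⟩, ⟨x, μ⟩, hrow ⟨x, μ⟩ h₀⟩) (constrEnum _ k ⟨⟨k, Nat.lt_succ_self k⟩, ⟨x.shift μ, ν⟩, hrow ⟨x.shift μ, ν⟩ hμ⟩)
    (constrEnum _ k ⟨⟨k, Nat.lt_succ_self k⟩, ⟨x.shift ν, μ⟩, hrow ⟨x.shift ν, μ⟩ hν⟩) (constrEnum _ k ⟨⟨k, Nat.lt_succ_self k⟩, ⟨x, ν⟩, hrow ⟨x, ν⟩ h₀⟩)
    (constrEnum_ne_of_ne _ (j := ⟨k, Nat.lt_succ_self k⟩) (c := ⟨⟨x.shift μ, ν⟩, hrow ⟨x.shift μ, ν⟩ hμ⟩) (c' := ⟨⟨x, μ⟩, hrow ⟨x, μ⟩ h₀⟩) fun h => hμν (congrArg PBond.dir h).symm)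
    (constrEnum_ne_of_ne _ (j := ⟨k, Nat.lt_succ_self k⟩) (c := ⟨⟨x.shift ν, μ⟩, hrow ⟨x.shift ν, μ⟩ hν⟩) (c' := ⟨⟨x, μ⟩, hrow ⟨x, μ⟩ h₀⟩) fun h => hx (congrArg PBond.src h))
    (constrEnum_ne_of_ne _ (j := ⟨k, Nat.lt_succ_self k⟩) (c := ⟨⟨x, ν⟩, hrow ⟨x, ν⟩ h₀⟩) (c' := ⟨⟨x, μ⟩, hrow ⟨x, μ⟩ h₀⟩) fun h => hμν (congrArg PBond.dir h).symm)
    (fun v => key v ⟨⟨k, Nat.lt_succ_self k⟩, ⟨x, μ⟩, hrow ⟨x, μ⟩ h₀⟩) (fun v => key v ⟨⟨k, Nat.lt_succ_self k⟩, ⟨x.shift μ, ν⟩, hrow ⟨x.shift μ, ν⟩ hμ⟩)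
    (fun v => key v ⟨⟨k, Nat.lt_succ_self k⟩, ⟨x.shift ν, μ⟩, hrow ⟨x.shift ν, μ⟩ hν⟩) (fun v => key v ⟨⟨k, Nat.lt_succ_self k⟩, ⟨x, ν⟩, hrow ⟨x, ν⟩ h₀⟩) w (hw _) hρ E

/-- ★★★ **THE FLOOR IN PRINT's η-UNITS**: with `q_η(v) := √(Σ_i ((L^d)∕(L²))^{j_i}·‖v i‖²)` (`j_i` the level of the `i`-th enumerated row; weights GROWING with the level, as the
minimal-norm cost `≍ L^{(d−2)j∕2}` of a unit level-`j` datum dictates) and `hρ : p(Rf v) ≤ ρ·q_η(v)`: for every `E ∈ 𝔰𝔲(N)`, **`‖↑E‖²_op ≤ 16·ρ²·‖E‖²_HS`** — a k-UNIFORM floor.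
[cite: Balaban1989LargeFieldII, (17)-(19) pp.360-361; Balaban1985Variational, (44)-(48) p.285; Balaban1988Convergent, (2.13) pp.256-257] -/
theorem letter_floor_fderiv_msChart_one_Bj_eta {k M₁ : ℕ} {Z : Set (Site (F.P K) 0)} (hk : k ≤ (F.P K).m + (F.P K).K) (x : Site (F.P K) k) {μ ν : Fin (F.P K).d}
    (hμν : μ ≠ ν) (hx : x.shift ν ≠ x) (h₀ : embIter k x ∈ maxDomT M₁ Z k) (hμ : embIter k (x.shift μ) ∈ maxDomT M₁ Z k) (hν : embIter k (x.shift ν) ∈ maxDomT M₁ Z k)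
    (p : Seminorm ℝ (PBond (F.P K) 0 → lieSU (Fin N))) (hp : ∀ Y : PBond (F.P K) 0 → lieSU (Fin N), ∑ b, ‖(Y b : Matrix (Fin N) (Fin N) ℂ)‖ ^ 2 ≤ p Y ^ 2)
    (Rf : (Fin (constrCard (Bj M₁ Z k : DetSet (F.P K)) k) → lieSU (Fin N)) → PBond (F.P K) 0 → lieSU (Fin N))
    (hRf : ∀ v, fderiv ℝ (msChart F N K k (Bj M₁ Z k) (avgFamily (avOfRecord F N K) (1 : GaugeField (F.P K) 0 (SU N))) (1 : GaugeField (F.P K) 0 (SU N))) 0 (Rf v) = v)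
    {ρ : ℝ} (hρ : ∀ v, p (Rf v) ≤ ρ * Real.sqrt (∑ i, ((((F.P K).L : ℝ) ^ (F.P K).d) / (((F.P K).L : ℝ) ^ 2)) ^ (((constrEnum (Bj M₁ Z k : DetSet (F.P K)) k).symm i).1 : ℕ) * ‖v i‖ ^ 2))
    (E : lieSU (Fin N)) :
    ‖(E : Matrix (Fin N) (Fin N) ℂ)‖ ^ 2 ≤ 16 * ρ ^ 2 * ‖E‖ ^ 2 := by
  have hL : (0 : ℝ) < ((F.P K).L : ℝ) := Nat.cast_pos.mpr (F.P K).L_pos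
  have hM : (0 : ℝ) < (((F.P K).L : ℝ) ^ (F.P K).d) ^ k := by positivity
  have h := letter_floor_fderiv_msChart_one_Bj_weighted hk x hμν hx h₀ hμ hν p hp Rf hRf
    (fun i => ((((F.P K).L : ℝ) ^ (F.P K).d) / (((F.P K).L : ℝ) ^ 2)) ^ (((constrEnum (Bj M₁ Z k : DetSet (F.P K)) k).symm i).1 : ℕ)) (fun i => by positivity) hρ E
  simp only [Equiv.symm_apply_apply] at h
  -- `(L²)^k · ((L^d)∕(L²))^k = (L^d)^k`
  have hwt : (((F.P K).L : ℝ) ^ 2) ^ k * ((((F.P K).L : ℝ) ^ (F.P K).d) / (((F.P K).L : ℝ) ^ 2)) ^ k = (((F.P K).L : ℝ) ^ (F.P K).d) ^ k := by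
    rw [← mul_pow, mul_div_cancel₀ _ (by positivity)]
  have h2 : (((F.P K).L : ℝ) ^ (F.P K).d) ^ k * ‖(E : Matrix (Fin N) (Fin N) ℂ)‖ ^ 2 ≤ (((F.P K).L : ℝ) ^ (F.P K).d) ^ k * (16 * ρ ^ 2 * ‖E‖ ^ 2) := by
    calc _ ≤ 16 * (((F.P K).L : ℝ) ^ 2) ^ k * ρ ^ 2 * (((((F.P K).L : ℝ) ^ (F.P K).d) / (((F.P K).L : ℝ) ^ 2)) ^ k * ‖E‖ ^ 2) := h
      _ = ((((F.P K).L : ℝ) ^ 2) ^ k * ((((F.P K).L : ℝ) ^ (F.P K).d) / (((F.P K).L : ℝ) ^ 2)) ^ k) * (16 * ρ ^ 2 * ‖E‖ ^ 2) := by ring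
      _ = (((F.P K).L : ℝ) ^ (F.P K).d) ^ k * (16 * ρ ^ 2 * ‖E‖ ^ 2) := by rw [hwt]
  exact le_of_mul_le_mul_left h2 hM

/-- ★★★ **THE FLOOR IN η-UNITS AS A NUMBER**: under the hypotheses of `letter_floor_fderiv_msChart_one_Bj_eta` and ONE non-zero `E ∈ 𝔰𝔲(N)` (`2 ≤ N`): **`1 ≤ 16·N·ρ²`**, i.e. `ρ ≥ 1∕(4√N)` for
every right inverse of J-C's flat `Lf` at `Bj M₁ Z k`, uniformly in `k`, in the volume and in the construction (H4's exchange lemma `‖E‖²_HS ≤ N·‖↑E‖²_op`).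
[cite: Balaban1989LargeFieldII, (17)-(19) pp.360-361; Balaban1985Variational, (44)-(48) p.285; Balaban1985Averaging, (17)-(19) p.21] -/
theorem letter_floor_fderiv_msChart_one_Bj_eta_numeral {k M₁ : ℕ} {Z : Set (Site (F.P K) 0)} (hk : k ≤ (F.P K).m + (F.P K).K) (x : Site (F.P K) k) {μ ν : Fin (F.P K).d}
    (hμν : μ ≠ ν) (hx : x.shift ν ≠ x) (h₀ : embIter k x ∈ maxDomT M₁ Z k) (hμ : embIter k (x.shift μ) ∈ maxDomT M₁ Z k) (hν : embIter k (x.shift ν) ∈ maxDomT M₁ Z k)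
    (p : Seminorm ℝ (PBond (F.P K) 0 → lieSU (Fin N))) (hp : ∀ Y : PBond (F.P K) 0 → lieSU (Fin N), ∑ b, ‖(Y b : Matrix (Fin N) (Fin N) ℂ)‖ ^ 2 ≤ p Y ^ 2)
    (Rf : (Fin (constrCard (Bj M₁ Z k : DetSet (F.P K)) k) → lieSU (Fin N)) → PBond (F.P K) 0 → lieSU (Fin N))
    (hRf : ∀ v, fderiv ℝ (msChart F N K k (Bj M₁ Z k) (avgFamily (avOfRecord F N K) (1 : GaugeField (F.P K) 0 (SU N))) (1 : GaugeField (F.P K) 0 (SU N))) 0 (Rf v) = v)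
    {ρ : ℝ} (hρ : ∀ v, p (Rf v) ≤ ρ * Real.sqrt (∑ i, ((((F.P K).L : ℝ) ^ (F.P K).d) / (((F.P K).L : ℝ) ^ 2)) ^ (((constrEnum (Bj M₁ Z k : DetSet (F.P K)) k).symm i).1 : ℕ) * ‖v i‖ ^ 2))
    {E : lieSU (Fin N)} (hE : E ≠ 0) : 1 ≤ 16 * (N : ℝ) * ρ ^ 2 := by
  have h := letter_floor_fderiv_msChart_one_Bj_eta hk x hμν hx h₀ hμ hν p hp Rf hRf hρ E
  have hEx := norm_sq_lieSU_le_card_mul_opNorm_sq E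
  have hE' : (E : Matrix (Fin N) (Fin N) ℂ) ≠ 0 := fun h0 => hE (Subtype.ext h0)
  have hpos : 0 < ‖(E : Matrix (Fin N) (Fin N) ℂ)‖ ^ 2 := by positivity
  have h2 : 1 * ‖(E : Matrix (Fin N) (Fin N) ℂ)‖ ^ 2 ≤ (16 * (N : ℝ) * ρ ^ 2) * ‖(E : Matrix (Fin N) (Fin N) ℂ)‖ ^ 2 := by
    calc 1 * ‖(E : Matrix (Fin N) (Fin N) ℂ)‖ ^ 2 = ‖(E : Matrix (Fin N) (Fin N) ℂ)‖ ^ 2 := one_mul _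
      _ ≤ 16 * ρ ^ 2 * ‖E‖ ^ 2 := h
      _ ≤ 16 * ρ ^ 2 * ((N : ℝ) * ‖(E : Matrix (Fin N) (Fin N) ℂ)‖ ^ 2) := mul_le_mul_of_nonneg_left hEx (by positivity)
      _ = (16 * (N : ℝ) * ρ ^ 2) * ‖(E : Matrix (Fin N) (Fin N) ℂ)‖ ^ 2 := by ring
  exact le_of_mul_le_mul_right h2 hpos

end Record

end Summit.QuantumFields.YangMills.BalabanUVNodes.N12FlatRightInverseLetterFloorWeighted
end
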